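import Literature.Analysis.FluidPDE.HalfLineOUBarrier
import HarnessLib

/-!
# Half-line Ornstein–Uhlenbeck comparison in the cubic growth class — VISCOSITY form

Topic `Literature/Analysis/FluidPDE` (family `ns`).  Companion of `HalfLineOU.halfLineOU_decay`
(`HalfLineOUComparison.lean`, the Prop `NetFlux.HalfLineOUDecay` of the net-flux line on crux `PoloidalLiouville`,
stmt-NavierStokesRegularity-1222, W1): the SAME decay `U(s,ρ) ≤ A·c·(1+ρ)³·e^{−λ(s−s₁)}` for a merely CONTINUOUS
`U` on `[s₁,∞) × [0,∞)` with `U(s,0) ≤ 0`, `U ≤ c(1+ρ)³` (`c ≥ 0`), which is a VISCOSITY subsolution of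
`∂ₛU ≤ U_ρρ + (C − ρ/2)U_ρ` in the open quadrant: whenever a test function `φ(σ,r)` — differentiable in `σ` at `s₀`,
twice differentiable in `r` on `ℝ` at time `s₀` — touches `U` from above at an interior point `(s₀,ρ₀)` (local maximum of
`U − φ`), `∂ₛφ ≤ φ_ρρ + (C − ρ₀/2)φ_ρ` there (`HalfLineOU.halfLineOU_decay_viscosity`).  This is the form in which
envelope constructions (suprema of smooth slice functions, cumulative integrals of continuous densities) deliver the
inequality without any differentiability of `U`.
Proof: the cubic barrier `K` of `HalfLineOU.exists_cubic_barrier` (`K″ + (C − ρ/2)K′ + λK ≤ 0`, `(1+ρ)³ ≤ A₀K ≤ A₀A₁(1+ρ)³`),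
`Φ = A₀ c e^{−λ(σ−s₁)}K`, the far-field supersolution `Z = e^{(12+4C)(σ−s₁)}(1+ρ⁴)` and the terminal-time penalty
`θ/(s̄−σ)`, `s̄ = s+1`: `Ψ = Φ + cηZ + θ/(s̄−σ)` is a STRICT supersolution, `U − Ψ ≤ 0` on the parabolic boundary of
`[s₁,s̄) × [0,R]` and `→ −∞` at `σ → s̄`, so a positive maximum would sit at an interior point, where the viscosity
inequality with test function `Ψ` contradicts strictness; then `θ, η → 0`, `R → ∞` is built into the choice
`R = ρ + 1 + 8/η`.  [cite: Lieberman1996, Ch. II Lemma 2.1 and Lemma 2.3 (weak maximum principle with a comparison function)]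
[cite: CrandallIshiiLions1992, §8 (parabolic viscosity sub-solutions; comparison with smooth strict supersolutions)]
WHAT THIS IS NOT: a statement about one linear 1-D inequality; nothing here proves or refutes `stub_scalarLiouville`,
`PoloidalLiouville` or Navier–Stokes regularity.  Author: ARM A `pub/ns-exp-scalarLiouville` g3 (offer to the NF-4
interface of ns-idea-14's net-flux line).
-/

noncomputable section

open Set Function Filter Topology
open scoped Topology

namespace Literature.Analysis.FluidPDE

namespace HalfLineOU

set_option maxHeartbeats 400000 in
/-- **Half-line OU decay in the cubic growth class, viscosity form.**  For every `C ≥ 0` there are `λ > 0` and `A`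
such that: if `U` is continuous on `[s₁,∞) × [0,∞)`, `U(s,0) ≤ 0`, `U(s,ρ) ≤ c(1+ρ)³` with `c ≥ 0`, and `U` is a
viscosity subsolution of `∂ₛU ≤ U_ρρ + (C − ρ/2)U_ρ` on `(s₁,∞) × (0,∞)` — for all `φ : ℝ → ℝ → ℝ`, `φₛ : ℝ`,
`φ₁ φ₂ : ℝ → ℝ` and `s₀ > s₁`, `ρ₀ > 0` with `HasDerivAt (φ · ρ₀) φₛ s₀`, `HasDerivAt (φ s₀) (φ₁ r) r` and
`HasDerivAt φ₁ (φ₂ r) r` for all `r`, and `(s₀,ρ₀)` a local maximum of `(σ,r) ↦ U σ r − φ σ r`, one has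
`φₛ ≤ φ₂ ρ₀ + (C − ρ₀/2)·φ₁ ρ₀` — then `U(s,ρ) ≤ A·c·(1+ρ)³·e^{−λ(s−s₁)}` for all `s ≥ s₁`, `ρ ≥ 0`.
[cite: Lieberman1996, Ch. II Lemma 2.1 and Lemma 2.3 (weak maximum principle with a comparison function)] -/
theorem halfLineOU_decay_viscosity : ∀ C : ℝ, 0 ≤ C → ∃ lam > 0, ∃ A : ℝ, ∀ (U : ℝ → ℝ → ℝ) (s₁ c : ℝ),
    ContinuousOn (uncurry U) (Ici s₁ ×ˢ Ici 0) →
    (∀ s, s₁ ≤ s → U s 0 ≤ 0) →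
    (∀ s, s₁ ≤ s → ∀ ρ, 0 ≤ ρ → U s ρ ≤ c * (1 + ρ) ^ 3) →
    0 ≤ c →
    (∀ (φ : ℝ → ℝ → ℝ) (φₛ : ℝ) (φ₁ φ₂ : ℝ → ℝ) (s₀ ρ₀ : ℝ), s₁ < s₀ → 0 < ρ₀ →
      HasDerivAt (fun σ => φ σ ρ₀) φₛ s₀ →
      (∀ r, HasDerivAt (φ s₀) (φ₁ r) r) → (∀ r, HasDerivAt φ₁ (φ₂ r) r) →
      IsLocalMax (fun p : ℝ × ℝ => U p.1 p.2 - φ p.1 p.2) (s₀, ρ₀) →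
      φₛ ≤ φ₂ ρ₀ + (C - ρ₀ / 2) * φ₁ ρ₀) →
    ∀ s, s₁ ≤ s → ∀ ρ, 0 ≤ ρ → U s ρ ≤ A * c * (1 + ρ) ^ 3 * Real.exp (-lam * (s - s₁)) := by
  intro C hC
  obtain ⟨K, K', K'', lam, ε, kM, hlam, hε, hkM, hK1, hK2, hKin, hKone, hKcub, hKup⟩ :=
    exists_cubic_barrier hC
  set A₀ : ℝ := 8 + 8 / ε with hA₀
  set A₁ : ℝ := kM + ε with hA₁
  have hA₀0 : 0 < A₀ := by rw [hA₀]; positivity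
  have hA₁0 : 0 < A₁ := by rw [hA₁]; positivity
  -- `(1+r)³ ≤ A₀ K r` and `K r ≤ A₁ (1+r)³`
  have h8A : (8 : ℝ) ≤ A₀ := by
    rw [hA₀]; have := div_pos (by norm_num : (0:ℝ) < 8) hε; linarith
  have hlow : ∀ r, 0 ≤ r → (1 + r) ^ 3 ≤ A₀ * K r := by
    intro r hr
    have h1 := hKone r hr
    have h2 := hKcub r hr
    rcases le_or_gt r 1 with hr1 | hr1
    · have h3 : (1 + r) ^ 3 ≤ (2 : ℝ) ^ 3 := pow_le_pow_left₀ (by linarith) (by linarith) 3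
      have h4 : (8 : ℝ) * 1 ≤ A₀ * K r := mul_le_mul h8A h1 zero_le_one hA₀0.le
      norm_num at h3
      linarith
    · have h3 : (1 + r) ^ 3 ≤ (2 * r) ^ 3 := pow_le_pow_left₀ (by linarith) (by linarith) 3
      have h3' : (2 * r) ^ 3 = 8 * r ^ 3 := by ring
      have h4 : 8 * r ^ 3 = (8 / ε) * (ε * r ^ 3) := by field_simp
      have h5 : (8 / ε) * (ε * r ^ 3) ≤ (8 / ε) * K r :=
        mul_le_mul_of_nonneg_left h2 (by positivity)
      have h6 : (8 / ε) * K r ≤ A₀ * K r := by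
        apply mul_le_mul_of_nonneg_right _ (by linarith)
        rw [hA₀]; linarith
      linarith
  have hup : ∀ r, 0 ≤ r → K r ≤ A₁ * (1 + r) ^ 3 := by
    intro r hr
    have h1 := hKup r hr
    have h2 : (1 : ℝ) ^ 3 ≤ (1 + r) ^ 3 := pow_le_pow_left₀ zero_le_one (by linarith) 3
    have h3 : r ^ 3 ≤ (1 + r) ^ 3 := pow_le_pow_left₀ hr (by linarith) 3
    rw [one_pow] at h2
    have h4 := mul_le_mul_of_nonneg_left h3 hε.le
    have h5 := mul_le_mul_of_nonneg_left h2 hkM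
    rw [hA₁]; linarith
  refine ⟨lam, hlam, A₀ * A₁, ?_⟩
  intro U s₁ c hcont h0 hbd hc0 hvisc s hs ρ hρ
  set ν : ℝ := 12 + 4 * C with hν
  have hν0 : 0 ≤ ν := by rw [hν]; linarith
  -- the comparison functions
  set Φ : ℝ → ℝ → ℝ := fun σ r => A₀ * c * Real.exp (-lam * (σ - s₁)) * K r with hΦ
  set Z : ℝ → ℝ → ℝ := fun σ r => Real.exp (ν * (σ - s₁)) * (1 + r ^ 4) with hZ
  have hΦnn : ∀ σ r, 0 ≤ r → 0 ≤ Φ σ r := fun σ r hr => by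
    rw [hΦ]; have := hKone r hr; positivity
  have hZnn : ∀ σ r, 0 ≤ Z σ r := fun σ r => by rw [hZ]; positivity
  -- derivative facts for `Φ`, `Z`
  have hΦt : ∀ σ r, HasDerivAt (fun τ => Φ τ r) ((-lam) * Φ σ r) σ := by
    intro σ r
    have h1 : HasDerivAt (fun τ => -lam * (τ - s₁)) (-lam * 1) σ :=
      ((hasDerivAt_id' σ).sub_const s₁).const_mul (-lam)
    have h2 := ((h1.exp).const_mul (A₀ * c)).mul_const (K r)
    refine h2.congr_deriv ?_
    show A₀ * c * (Real.exp (-lam * (σ - s₁)) * (-lam * 1)) * K r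
      = -lam * (A₀ * c * Real.exp (-lam * (σ - s₁)) * K r)
    ring
  have hZt : ∀ σ r, HasDerivAt (fun τ => Z τ r) (ν * Z σ r) σ := by
    intro σ r
    have h1 : HasDerivAt (fun τ => ν * (τ - s₁)) (ν * 1) σ :=
      ((hasDerivAt_id' σ).sub_const s₁).const_mul ν
    have h2 := (h1.exp).mul_const (1 + r ^ 4)
    refine h2.congr_deriv ?_
    show Real.exp (ν * (σ - s₁)) * (ν * 1) * (1 + r ^ 4) = ν * (Real.exp (ν * (σ - s₁)) * (1 + r ^ 4))
    ring
  have hΦr : ∀ σ r, HasDerivAt (Φ σ) (A₀ * c * Real.exp (-lam * (σ - s₁)) * K' r) r :=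
    fun σ r => (hK1 r).const_mul _
  have hΦrr : ∀ σ r, HasDerivAt (fun r => A₀ * c * Real.exp (-lam * (σ - s₁)) * K' r)
      (A₀ * c * Real.exp (-lam * (σ - s₁)) * K'' r) r := fun σ r => (hK2 r).const_mul _
  have hZr : ∀ σ r, HasDerivAt (Z σ) (Real.exp (ν * (σ - s₁)) * (4 * r ^ 3)) r := by
    intro σ r
    have h0 : HasDerivAt (fun r : ℝ => r ^ 4) (4 * r ^ 3) r := by simpa using hasDerivAt_pow 4 r
    exact ((h0.const_add 1).const_mul (Real.exp (ν * (σ - s₁)))).congr_deriv (by ring)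
  have hZrr : ∀ σ r, HasDerivAt (fun r => Real.exp (ν * (σ - s₁)) * (4 * r ^ 3))
      (Real.exp (ν * (σ - s₁)) * (12 * r ^ 2)) r := by
    intro σ r
    have h0 : HasDerivAt (fun r : ℝ => r ^ 3) (3 * r ^ 2) r := by simpa using hasDerivAt_pow 3 r
    exact ((h0.const_mul 4).const_mul (Real.exp (ν * (σ - s₁)))).congr_deriv (by ring)
  -- continuity of `K`, `Φ`, `Z`
  have hKc : Continuous K := continuous_iff_continuousAt.2 fun r => (hK1 r).continuousAt
  have hΦc : Continuous (uncurry Φ) := by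
    rw [hΦ]
    show Continuous fun p : ℝ × ℝ => A₀ * c * Real.exp (-lam * (p.1 - s₁)) * K p.2
    fun_prop
  have hZc : Continuous (uncurry Z) := by
    rw [hZ]
    show Continuous fun p : ℝ × ℝ => Real.exp (ν * (p.1 - s₁)) * (1 + p.2 ^ 4)
    fun_prop
  -- the algebraic supersolution inequality of `Z`
  have hZineq : ∀ x : ℝ, 0 < x → 12 * x ^ 2 + (C - x / 2) * (4 * x ^ 3) ≤ ν * (1 + x ^ 4) := by
    intro x hx0
    rw [hν]
    have h1 : x ^ 2 ≤ 1 + x ^ 4 := by nlinarith only [sq_nonneg (x ^ 2 - 1), sq_nonneg x]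
    have h4 : 0 ≤ x ^ 4 := pow_nonneg hx0.le 4
    have h2 : x ^ 3 ≤ 1 + x ^ 4 := by
      have hsos : 0 ≤ (x - 1) ^ 2 * (3 * x ^ 2 + 2 * x + 1) :=
        mul_nonneg (sq_nonneg _) (by positivity)
      linarith only [hsos, h4]
    have h5 := mul_le_mul_of_nonneg_left h2 (by linarith : (0:ℝ) ≤ 4 * C)
    linarith only [h1, h5, h4]
  -- MAIN CLAIM: `U s ρ ≤ Φ s ρ + c η Z s ρ + θ` for every `η, θ > 0`
  have key : ∀ η θ : ℝ, 0 < η → 0 < θ → U s ρ ≤ Φ s ρ + c * η * Z s ρ + θ := by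
    intro η θ hη hθ
    set R : ℝ := ρ + 1 + 8 / η with hR
    have hR1 : 1 ≤ R := by rw [hR]; have := div_pos (by norm_num : (0:ℝ) < 8) hη; linarith
    have hρR : ρ < R := by rw [hR]; have := div_pos (by norm_num : (0:ℝ) < 8) hη; linarith
    have hRη : (1 + R) ^ 3 ≤ η * (1 + R ^ 4) := by
      have h1 : (1 + R) ^ 3 ≤ (2 * R) ^ 3 := pow_le_pow_left₀ (by linarith) (by linarith) 3
      have h1' : (2 * R) ^ 3 = 8 * R ^ 3 := by ring
      have h2 : 8 / η ≤ R := by rw [hR]; linarith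
      have h3 : 8 ≤ η * R := by
        have := mul_le_mul_of_nonneg_left h2 hη.le
        rwa [mul_div_cancel₀ _ hη.ne'] at this
      have hR3 : 0 ≤ R ^ 3 := by positivity
      have h4 : 8 * R ^ 3 ≤ η * R * R ^ 3 := mul_le_mul_of_nonneg_right h3 hR3
      have h5 : η * R * R ^ 3 = η * R ^ 4 := by ring
      have h6 : η * R ^ 4 ≤ η * (1 + R ^ 4) := by nlinarith [hη.le]
      linarith
    -- terminal time `s̄ = s + 1`, penalty `θ/(s̄ − σ)`, cut time `s̄ − δ`
    set sbar : ℝ := s + 1 with hsbar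
    set M : ℝ := c * (1 + R) ^ 3 + 1 with hM
    have hM0 : 0 < M := by rw [hM]; positivity
    set δ : ℝ := min 1 (θ / M) / 2 with hδ
    have hδ0 : 0 < δ := by rw [hδ]; have := div_pos hθ hM0; positivity
    have hδ1 : δ ≤ 1 / 2 := by rw [hδ]; have := min_le_left (1 : ℝ) (θ / M); linarith
    have hδθ : δ < θ / M := by
      rw [hδ]; have := min_le_right (1 : ℝ) (θ / M); have := div_pos hθ hM0; linarith
    set Ψ : ℝ → ℝ → ℝ := fun σ r => Φ σ r + c * η * Z σ r + θ * (sbar - σ)⁻¹ with hΨ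
    set g : ℝ → ℝ → ℝ := fun σ r => U σ r - Ψ σ r with hg
    -- the box `B = [s₁, s̄ − δ] × [0, R]`
    set B : Set (ℝ × ℝ) := Icc s₁ (sbar - δ) ×ˢ Icc 0 R with hB
    have hsB : s ≤ sbar - δ := by rw [hsbar]; linarith
    have hBc : IsCompact B := isCompact_Icc.prod isCompact_Icc
    have hBne : B.Nonempty := ⟨(s, ρ), ⟨hs, hsB⟩, ⟨hρ, hρR.le⟩⟩
    -- continuity of `g` on `B`
    have hpen : ContinuousOn (fun p : ℝ × ℝ => θ * (sbar - p.1)⁻¹) B := by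
      refine continuousOn_const.mul (ContinuousOn.inv₀ (by fun_prop) fun p hp => ?_)
      have : p.1 ≤ sbar - δ := hp.1.2
      linarith
    have hgc : ContinuousOn (uncurry g) B := by
      have hU : ContinuousOn (uncurry U) B := hcont.mono (prod_mono Icc_subset_Ici_self Icc_subset_Ici_self)
      have h1 : ContinuousOn (fun p : ℝ × ℝ => uncurry U p -
          (uncurry Φ p + c * η * uncurry Z p + θ * (sbar - p.1)⁻¹)) B :=
        hU.sub ((hΦc.continuousOn.add ((hZc.continuousOn).const_smul (c * η) |>.congr
          (fun p _ => by simp [smul_eq_mul]))).add hpen)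
      exact h1.congr fun p _ => by rcases p with ⟨σ, r⟩; rfl
    -- a maximum point of `g` on `B`
    obtain ⟨p₀, hp₀B, hmax⟩ := hBc.exists_isMaxOn hBne hgc
    -- it suffices that the maximum is `≤ 0`
    suffices hmax0 : uncurry g p₀ ≤ 0 by
      have h1 : uncurry g (s, ρ) ≤ uncurry g p₀ := hmax ⟨⟨hs, hsB⟩, ⟨hρ, hρR.le⟩⟩
      have h2 : g s ρ ≤ 0 := h1.trans hmax0
      have h3 : θ * (sbar - s)⁻¹ = θ := by rw [hsbar]; simp
      have h4 : g s ρ = U s ρ - (Φ s ρ + c * η * Z s ρ + θ * (sbar - s)⁻¹) := rfl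
      rw [h3] at h4
      linarith only [h1, hmax0, h2, h4]
    by_contra hpos
    push Not at hpos
    obtain ⟨σ₀, r₀⟩ := p₀
    have hσ₀ : σ₀ ∈ Icc s₁ (sbar - δ) := hp₀B.1
    have hr₀ : r₀ ∈ Icc 0 R := hp₀B.2
    have hgval : g σ₀ r₀ = U σ₀ r₀ - (Φ σ₀ r₀ + c * η * Z σ₀ r₀ + θ * (sbar - σ₀)⁻¹) := rfl
    have hpos' : 0 < g σ₀ r₀ := hpos
    have hden0 : 0 < sbar - σ₀ := by linarith [hσ₀.2]
    have hpen0 : 0 < θ * (sbar - σ₀)⁻¹ := mul_pos hθ (inv_pos.2 hden0)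
    have hΦ0 := hΦnn σ₀ r₀ hr₀.1
    have hZ0 : 0 ≤ c * η * Z σ₀ r₀ := by have := hZnn σ₀ r₀; positivity
    -- (i) not on the bottom `σ₀ = s₁`
    have hσ₀gt : s₁ < σ₀ := by
      rcases eq_or_lt_of_le hσ₀.1 with h | h
      · exfalso
        have h1 := hbd s₁ le_rfl r₀ hr₀.1
        have h2 : c * (1 + r₀) ^ 3 ≤ Φ s₁ r₀ := by
          show c * (1 + r₀) ^ 3 ≤ A₀ * c * Real.exp (-lam * (s₁ - s₁)) * K r₀
          rw [sub_self, mul_zero, Real.exp_zero, mul_one]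
          nlinarith [mul_le_mul_of_nonneg_left (hlow r₀ hr₀.1) hc0]
        rw [← h] at hgval hpos' hpen0 hZ0
        linarith only [hgval, hpos', hpen0, hZ0, h1, h2]
      · exact h
    -- (ii) not at the cut time `σ₀ = s̄ − δ` (there `g < 0`, since the penalty exceeds `c(1+R)³`)
    have hσ₀lt : σ₀ < sbar - δ := by
      rcases eq_or_lt_of_le hσ₀.2 with h | h
      · exfalso
        have h1 := hbd σ₀ hσ₀.1 r₀ hr₀.1
        have h2 : c * (1 + r₀) ^ 3 ≤ c * (1 + R) ^ 3 := by
          have : (1 + r₀) ^ 3 ≤ (1 + R) ^ 3 := pow_le_pow_left₀ (by linarith [hr₀.1]) (by linarith [hr₀.2]) 3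
          exact mul_le_mul_of_nonneg_left this hc0
        have h3 : M ≤ θ * (sbar - σ₀)⁻¹ := by
          rw [h, sub_sub_cancel, ← div_eq_mul_inv, le_div_iff₀ hδ0]
          have := (lt_div_iff₀ hM0).1 hδθ
          linarith only [this]
        rw [hM] at h3
        linarith only [hgval, hpos', h1, h2, h3, hΦ0, hZ0]
      · exact h
    -- (iii) not on the lateral boundary `r₀ = 0` or `r₀ = R`
    have hr₀gt : 0 < r₀ := by
      rcases eq_or_lt_of_le hr₀.1 with h | h
      · exfalso
        rw [← h] at hgval hpos' hΦ0 hZ0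
        have h1 := h0 σ₀ hσ₀.1
        linarith only [hgval, hpos', hΦ0, hZ0, h1, hpen0]
      · exact h
    have hr₀lt : r₀ < R := by
      rcases eq_or_lt_of_le hr₀.2 with h | h
      · exfalso
        rw [h] at hgval hpos' hΦ0 hZ0
        have h1 := hbd σ₀ hσ₀.1 R (by linarith)
        have h2 : c * (1 + R) ^ 3 ≤ c * η * Z σ₀ R := by
          show c * (1 + R) ^ 3 ≤ c * η * (Real.exp (ν * (σ₀ - s₁)) * (1 + R ^ 4))
          have he : 1 ≤ Real.exp (ν * (σ₀ - s₁)) := by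
            apply Real.one_le_exp; exact mul_nonneg hν0 (by linarith [hσ₀.1])
          have h3 : η * (1 + R ^ 4) ≤ η * (Real.exp (ν * (σ₀ - s₁)) * (1 + R ^ 4)) := by
            have : (1 + R ^ 4) ≤ Real.exp (ν * (σ₀ - s₁)) * (1 + R ^ 4) :=
              le_mul_of_one_le_left (by positivity) he
            exact mul_le_mul_of_nonneg_left this hη.le
          calc c * (1 + R) ^ 3 ≤ c * (η * (Real.exp (ν * (σ₀ - s₁)) * (1 + R ^ 4))) :=
                mul_le_mul_of_nonneg_left (hRη.trans h3) hc0
            _ = c * η * (Real.exp (ν * (σ₀ - s₁)) * (1 + R ^ 4)) := by ring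
        linarith only [hgval, hpos', hΦ0, h1, h2, hpen0]
      · exact h
    -- (iv) interior point: a local maximum of `U − Ψ` in `ℝ × ℝ`
    have hBnhds : B ∈ 𝓝 (σ₀, r₀) := by
      rw [hB]
      exact prod_mem_nhds (Icc_mem_nhds hσ₀gt hσ₀lt) (Icc_mem_nhds hr₀gt hr₀lt)
    have hloc : IsLocalMax (fun p : ℝ × ℝ => U p.1 p.2 - Ψ p.1 p.2) (σ₀, r₀) := by
      have h1 : IsMaxOn (uncurry g) B (σ₀, r₀) := hmax
      have h2 : IsLocalMax (uncurry g) (σ₀, r₀) := h1.isLocalMax hBnhds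
      exact h2
    -- the test function data of `Ψ` at `(σ₀, r₀)`
    have hpent : HasDerivAt (fun σ => θ * (sbar - σ)⁻¹) (θ * ((sbar - σ₀) ^ 2)⁻¹) σ₀ := by
      have h1 : HasDerivAt (fun σ => sbar - σ) (-1) σ₀ := by
        simpa using (hasDerivAt_id σ₀).const_sub sbar
      have h2 := h1.inv hden0.ne'
      have h3 := h2.const_mul θ
      refine h3.congr_deriv ?_
      rw [neg_neg, one_div]
    set Ψs : ℝ := (-lam) * Φ σ₀ r₀ + c * η * (ν * Z σ₀ r₀) + θ * ((sbar - σ₀) ^ 2)⁻¹ with hΨs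
    have hΨt : HasDerivAt (fun σ => Ψ σ r₀) Ψs σ₀ :=
      ((hΦt σ₀ r₀).add ((hZt σ₀ r₀).const_mul (c * η))).add hpent
    set Ψ₁ : ℝ → ℝ := fun r => A₀ * c * Real.exp (-lam * (σ₀ - s₁)) * K' r
      + c * η * (Real.exp (ν * (σ₀ - s₁)) * (4 * r ^ 3)) with hΨ₁
    set Ψ₂ : ℝ → ℝ := fun r => A₀ * c * Real.exp (-lam * (σ₀ - s₁)) * K'' r
      + c * η * (Real.exp (ν * (σ₀ - s₁)) * (12 * r ^ 2)) with hΨ₂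
    have hΨr : ∀ r, HasDerivAt (Ψ σ₀) (Ψ₁ r) r := by
      intro r
      exact ((hΦr σ₀ r).add ((hZr σ₀ r).const_mul (c * η))).add_const (θ * (sbar - σ₀)⁻¹)
    have hΨrr : ∀ r, HasDerivAt Ψ₁ (Ψ₂ r) r := fun r =>
      (hΦrr σ₀ r).add ((hZrr σ₀ r).const_mul (c * η))
    -- the viscosity inequality at the touching point
    have hV := hvisc Ψ Ψs Ψ₁ Ψ₂ σ₀ r₀ hσ₀gt hr₀gt hΨt hΨr hΨrr hloc
    -- … contradicts strict supersolution: barrier inequalities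
    have hKx := hKin r₀ hr₀gt
    have hexp0 : 0 ≤ A₀ * c * Real.exp (-lam * (σ₀ - s₁)) := by positivity
    have hexpZ : 0 ≤ c * η * Real.exp (ν * (σ₀ - s₁)) := by positivity
    have hpen2 : 0 < θ * ((sbar - σ₀) ^ 2)⁻¹ := mul_pos hθ (inv_pos.2 (pow_pos hden0 2))
    have hV' : (-lam) * (A₀ * c * Real.exp (-lam * (σ₀ - s₁)) * K r₀)
        + c * η * (ν * (Real.exp (ν * (σ₀ - s₁)) * (1 + r₀ ^ 4))) + θ * ((sbar - σ₀) ^ 2)⁻¹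
        ≤ (A₀ * c * Real.exp (-lam * (σ₀ - s₁)) * K'' r₀ + c * η * (Real.exp (ν * (σ₀ - s₁)) * (12 * r₀ ^ 2)))
          + (C - r₀ / 2) * (A₀ * c * Real.exp (-lam * (σ₀ - s₁)) * K' r₀
            + c * η * (Real.exp (ν * (σ₀ - s₁)) * (4 * r₀ ^ 3))) := hV
    generalize hEx : A₀ * c * Real.exp (-lam * (σ₀ - s₁)) = Ex at hV' hexp0
    generalize hEz : Real.exp (ν * (σ₀ - s₁)) = Ez at hV' hexpZ
    generalize hP : θ * ((sbar - σ₀) ^ 2)⁻¹ = P at hV' hpen2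
    have hbar : Ex * (K'' r₀ + (C - r₀ / 2) * K' r₀ + lam * K r₀) ≤ Ex * 0 :=
      mul_le_mul_of_nonneg_left hKx hexp0
    have hZf : c * η * Ez * (12 * r₀ ^ 2 + (C - r₀ / 2) * (4 * r₀ ^ 3)) ≤ c * η * Ez * (ν * (1 + r₀ ^ 4)) :=
      mul_le_mul_of_nonneg_left (hZineq r₀ hr₀gt) hexpZ
    linarith only [hV', hbar, hZf, hpen2]
  -- let `θ, η → 0`
  have hlim : U s ρ ≤ Φ s ρ := by
    apply le_of_forall_pos_le_add
    intro e he
    have hZ0 := hZnn s ρ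
    set η : ℝ := (e / 2) / (c * Z s ρ + 1) with hη
    have hden : 0 < c * Z s ρ + 1 := by positivity
    have hη0 : 0 < η := div_pos (by linarith) hden
    have h1 := key η (e / 2) hη0 (by linarith)
    have h2 : c * η * Z s ρ ≤ e / 2 := by
      have : c * η * Z s ρ = (e / 2) * (c * Z s ρ / (c * Z s ρ + 1)) := by rw [hη]; field_simp
      rw [this]
      have : c * Z s ρ / (c * Z s ρ + 1) ≤ 1 := by
        rw [div_le_one hden]; linarith
      nlinarith
    linarith
  -- `Φ s ρ ≤ A₀ A₁ c (1+ρ)³ e^{−λ(s−s₁)}`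
  calc U s ρ ≤ Φ s ρ := hlim
    _ = A₀ * c * Real.exp (-lam * (s - s₁)) * K ρ := rfl
    _ ≤ A₀ * c * Real.exp (-lam * (s - s₁)) * (A₁ * (1 + ρ) ^ 3) :=
        mul_le_mul_of_nonneg_left (hup ρ hρ) (by positivity)
    _ = A₀ * A₁ * c * (1 + ρ) ^ 3 * Real.exp (-lam * (s - s₁)) := by ring

end HalfLineOU

end Literature.Analysis.FluidPDE

end
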